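import Mathlib
import HarnessLib
import Summits.MatrixMultiplication.MatrixMultiplication.Theorems.FarEdgeDescentFloorDial
import Summits.MatrixMultiplication.MatrixMultiplication.Theorems.FarEdgeDescentChainCapSteps

/-!
# Far-edge descent, kernel XLII-B — the schedule cap XL-D from a pair criterion for ANY potential (model level)

Kernel XL-D / XLI-A (`FarEdgeDescentFloorDial`) typed the cap conjecture of the β-dial over all binary
schedules `Sched`:  for `2 ≤ a`, `1 < β < 2`, `0 ≤ R` and base deviations `0 ≤ y₀(b) ≤ R/(b+β)`,
`∃ C, ∀ s, Admissible a β s → dev β y₀ s ≤ C · logSize β s ^ κ_S`, `κ_S = log(4/3)/log 2`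
(Schönhage's order).  Kernel XLI-A (`FarEdgeDescentTreeCap`) proved the cap over product trees of
HEAVY bases for the linear two-share potential `w + ελ`, given a pair criterion; memo g61 §3 and the
critic's β-sweep showed that potential (and every constant-weight multi-tail variant) fails beyond
`β ≈ 1.575`, and memo g62 §3 replaced it by the single-scale NARROWNESS potential
`Φ_{z,ε} = λ·(ε + 1 − V(z))` with `z = 24/25`, `ε = 1/50`, whose pair criterion holds on the pinned
region of kernel XLII-A at every sampled `β ∈ [3/2, 1.995]`.

THIS FILE is the potential-independent half of that argument, stated directly over `Sched`:
* `share_range`: admissible schedules have `Q ≥ 0`, `L > 0` and share `0 < λ ≤ 1/β`;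
* `cap_of_pair_criterion`: for ANY `Φ : Sched → ℝ`, ANY exponent `κ ≥ 0` and `U ≥ 0`, a LEAF BOUND
  `y₀(b) ≤ U·Φ(base b)·logSize(base b)^κ` and the PAIR CRITERION at every admissible node,
  `(1−(β−1)λ_t)·Φ_s·x^κ + (1−(β−1)λ_s)·Φ_t·(1−x)^κ ≤ Φ_{s⊗t}` for all `x ∈ [0,1]`,
  give `dev β y₀ s ≤ U·Φ(s)·logSize(s)^κ` on every admissible schedule (three-line structural
  induction; at a node `x = ℓ_s/(ℓ_s+ℓ_t)`);
* `cap_of_potential`: if moreover `Φ(base b) ≥ φ₀·share(base b)` (`φ₀ > 0`) and `Φ ≤ M` on admissible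
  schedules, then the XL-D conclusion holds with the explicit constant `C = R·M/(φ₀·(log β)^κ)`.
So the cap conjecture XL-D (with the exact exponent `κ_S`, or any `κ`) is REDUCED to exhibiting one
potential with a leaf bound, a global bound and the pair criterion; memo g62 §3 exhibits `Φ_{z,ε}`
and certifies its criterion numerically on the pinned region (W)∧(Q)∧floors of kernel XLII-A.

HONEST FRAMING: MODEL level (the schedule grammar of XLI-A); the pair criterion is a HYPOTHESIS here;
no `sorry`, no new axioms, no new definitions.  Nothing here touches `_root_.MatrixMultiplication`
or the `closes` cut of the route.  References: Schönhage 1981, Thm. 3 [Schonhage1981];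
Coppersmith–Winograd [CoppersmithWinograd1990]; kernels XL-D, XLI-A, XLII-A; memo g62.
-/

noncomputable section

set_option linter.dupNamespace false

namespace Summit.MatrixMultiplication.MatrixMultiplication.Theorems.FarEdgeDescentPotentialCap

open Summit.MatrixMultiplication.MatrixMultiplication.Theorems.FarEdgeDescentFloorDial
open Summit.MatrixMultiplication.MatrixMultiplication.Theorems.FarEdgeDescentFloorDial.Sched
open Summit.MatrixMultiplication.MatrixMultiplication.Theorems.FarEdgeDescentChainCapSteps

/-! ## Shares of admissible schedules -/

/-- Admissible schedules (`1 ≤ β`) have nonnegative anchor and positive leg mass. -/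
theorem anchor_legMass {a β : ℝ} (hβ : 1 ≤ β) :
    ∀ s : Sched, Admissible a β s → 0 ≤ anchor β s ∧ 0 < legMass β s
  | base b, h => by
      refine ⟨?_, by rw [legMass_base]; exact one_pos⟩
      show 0 ≤ (qp β (base b)).1
      rw [qp_base]; exact h.1
  | node s t, h => by
      obtain ⟨hQs, hLs⟩ := anchor_legMass hβ s h.1
      obtain ⟨hQt, hLt⟩ := anchor_legMass hβ t h.2.1
      have hb : 0 ≤ β * (β - 1) := mul_nonneg (by linarith) (by linarith)
      refine ⟨?_, ?_⟩
      · rw [(qp_node β s t).1]; positivity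
      · rw [legMass_node]; positivity

/-- **Share range.**  An admissible schedule has `0 < λ` and `β·λ ≤ 1`; in particular both damping
factors `1 − (β−1)λ` and `1 − βλ` are nonnegative. -/
theorem share_range {a β : ℝ} (hβ : 1 ≤ β) (s : Sched) (hs : Admissible a β s) :
    0 < share β s ∧ β * share β s ≤ 1 ∧ 0 ≤ 1 - (β - 1) * share β s := by
  obtain ⟨hQ, hL⟩ := anchor_legMass hβ s hs
  have hβ0 : 0 < β := by linarith
  have hr : 0 < anchor β s + β * legMass β s := by positivity
  have hsh : share β s = legMass β s / (anchor β s + β * legMass β s) := rfl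
  have h1 : 0 < share β s := by rw [hsh]; positivity
  have h2 : β * share β s ≤ 1 := by rw [hsh, mul_div_assoc', div_le_one hr]; linarith
  refine ⟨h1, h2, ?_⟩
  nlinarith

/-! ## The cap from a pair criterion, for any potential -/

set_option maxHeartbeats 400000 in
/-- **Cap from the pair criterion (any potential, any exponent).**  Let `1 < β`, `0 ≤ κ`, `0 ≤ U`,
`Φ : Sched → ℝ`.  If every admissible base obeys the LEAF BOUND `y₀ b ≤ U·Φ(base b)·logSize^κ` and
every admissible node obeys the PAIR CRITERION
`(1−(β−1)λ_t)Φ_s·x^κ + (1−(β−1)λ_s)Φ_t·(1−x)^κ ≤ Φ_{s⊗t}` for all `x ∈ [0,1]`, then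
`dev β y₀ s ≤ U·Φ(s)·logSize(s)^κ` on every admissible schedule. -/
theorem cap_of_pair_criterion {a β κ U : ℝ} (hβ : 1 < β) (hκ : 0 ≤ κ) (hU : 0 ≤ U)
    (Φ : Sched → ℝ) (y₀ : ℝ → ℝ)
    (hleaf : ∀ b : ℝ, Admissible a β (base b) →
      y₀ b ≤ U * Φ (base b) * logSize β (base b) ^ κ)
    (hpair : ∀ s t : Sched, Admissible a β (node s t) → ∀ x : ℝ, 0 ≤ x → x ≤ 1 →
      (1 - (β - 1) * share β t) * Φ s * x ^ κ + (1 - (β - 1) * share β s) * Φ t * (1 - x) ^ κ ≤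
        Φ (node s t)) :
    ∀ s : Sched, Admissible a β s → dev β y₀ s ≤ U * Φ s * logSize β s ^ κ
  | base b, h => hleaf b h
  | node s t, h => by
      obtain ⟨hs, ht, _⟩ := h
      have ihs := cap_of_pair_criterion hβ hκ hU Φ y₀ hleaf hpair s hs
      have iht := cap_of_pair_criterion hβ hκ hU Φ y₀ hleaf hpair t ht
      obtain ⟨-, -, hns⟩ := share_range hβ.le s hs
      obtain ⟨-, -, hnt⟩ := share_range hβ.le t ht
      have hℓs := logSize_pos hβ s hs
      have hℓt := logSize_pos hβ t ht
      have hsz : 0 < logSize β s + logSize β t := by linarith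
      -- the size ratio
      set x := logSize β s / (logSize β s + logSize β t) with hx
      have hx0 : 0 ≤ x := div_nonneg hℓs.le hsz.le
      have hx1 : x ≤ 1 := by rw [hx, div_le_one hsz]; linarith
      have hxs : logSize β s = x * (logSize β s + logSize β t) := by rw [hx]; field_simp
      have hxt : logSize β t = (1 - x) * (logSize β s + logSize β t) := by
        rw [hx]; field_simp; ring
      have hpow_s : logSize β s ^ κ = x ^ κ * (logSize β s + logSize β t) ^ κ := by
        rw [hxs, Real.mul_rpow hx0 hsz.le, ← hxs]
      have hpow_t : logSize β t ^ κ = (1 - x) ^ κ * (logSize β s + logSize β t) ^ κ := by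
        rw [hxt, Real.mul_rpow (by linarith) hsz.le, ← hxt]
      have hC := hpair s t ⟨hs, ht, ‹_›⟩ x hx0 hx1
      have hS0 : 0 ≤ (logSize β s + logSize β t) ^ κ := Real.rpow_nonneg hsz.le κ
      show (1 - (β - 1) * share β t) * dev β y₀ s + (1 - (β - 1) * share β s) * dev β y₀ t ≤
        U * Φ (node s t) * (logSize β s + logSize β t) ^ κ
      have h1 : (1 - (β - 1) * share β t) * dev β y₀ s ≤
          (1 - (β - 1) * share β t) * (U * Φ s * logSize β s ^ κ) :=
        mul_le_mul_of_nonneg_left ihs hnt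
      have h2 : (1 - (β - 1) * share β s) * dev β y₀ t ≤
          (1 - (β - 1) * share β s) * (U * Φ t * logSize β t ^ κ) :=
        mul_le_mul_of_nonneg_left iht hns
      have h3 := mul_le_mul_of_nonneg_left (mul_le_mul_of_nonneg_right hC hS0) hU
      rw [hpow_s] at h1
      rw [hpow_t] at h2
      nlinarith [h1, h2, h3]

/-! ## The XL-D conclusion from a potential -/

/-- Leaf bound from a share-proportional potential at the bases: if `0 ≤ y₀ b ≤ R/(b+β)` and
`φ₀·share(base b) ≤ Φ(base b)` with `φ₀ > 0`, `1 < β`, `0 ≤ b`, then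
`y₀ b ≤ R/(φ₀ (log β)^κ) · Φ(base b) · logSize(base b)^κ`. -/
theorem leaf_bound {β R κ φ₀ : ℝ} (hβ : 1 < β) (hκ : 0 ≤ κ) (hR : 0 ≤ R) (hφ₀ : 0 < φ₀)
    (Φ : Sched → ℝ) (y₀ : ℝ → ℝ) {b : ℝ} (hb : 0 ≤ b) (hy : y₀ b ≤ R / (b + β))
    (hΦ : φ₀ * share β (base b) ≤ Φ (base b)) :
    y₀ b ≤ R / (φ₀ * Real.log β ^ κ) * Φ (base b) * logSize β (base b) ^ κ := by
  have hlogβ : 0 < Real.log β := Real.log_pos hβ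
  have hpowβ : 0 < Real.log β ^ κ := Real.rpow_pos_of_pos hlogβ κ
  have hbb : 0 < b + β := by linarith
  have hℓ : logSize β (base b) = Real.log (b + β) := rfl
  have hlog_le : Real.log β ≤ Real.log (b + β) := Real.log_le_log (by linarith) (by linarith)
  have hpow : Real.log β ^ κ ≤ logSize β (base b) ^ κ := by
    rw [hℓ]; exact Real.rpow_le_rpow hlogβ.le hlog_le hκ
  have hshare : share β (base b) = 1 / (b + β) := share_base β b
  -- y₀ b ≤ R·share ≤ (R/φ₀)·Φ(base b)
  have h1 : y₀ b ≤ R * share β (base b) := by rw [hshare, mul_one_div]; exact hy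
  have h2 : R * share β (base b) ≤ R / φ₀ * Φ (base b) := by
    rw [div_mul_eq_mul_div, le_div_iff₀ hφ₀]
    calc R * share β (base b) * φ₀ = R * (φ₀ * share β (base b)) := by ring
      _ ≤ R * Φ (base b) := mul_le_mul_of_nonneg_left hΦ hR
  have hΦ0 : 0 ≤ Φ (base b) := le_trans (mul_nonneg hφ₀.le (by rw [hshare]; positivity)) hΦ
  have h3 : R / φ₀ * Φ (base b) ≤ R / (φ₀ * Real.log β ^ κ) * Φ (base b) * logSize β (base b) ^ κ := by
    have e : R / (φ₀ * Real.log β ^ κ) * Φ (base b) * logSize β (base b) ^ κ =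
        R / φ₀ * Φ (base b) * (logSize β (base b) ^ κ / Real.log β ^ κ) := by
      field_simp
    rw [e]
    have hratio : 1 ≤ logSize β (base b) ^ κ / Real.log β ^ κ := by
      rw [le_div_iff₀ hpowβ]; linarith
    have h0 : 0 ≤ R / φ₀ * Φ (base b) := mul_nonneg (div_nonneg hR hφ₀.le) hΦ0
    nlinarith
  linarith

/-- **The cap conjecture XL-D from a potential.**  Let `1 < β`, `0 ≤ κ`, `0 ≤ R`, base deviations
`0 ≤ y₀ b ≤ R/(b+β)` (`b ≥ 0`), and `Φ : Sched → ℝ` with (i) `Φ(base b) ≥ φ₀·share(base b)` for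
`b ≥ 0` (`φ₀ > 0`), (ii) `Φ ≤ M` on admissible schedules, (iii) the pair criterion at every
admissible node.  Then `dev β y₀ s ≤ C·logSize β s ^ κ` on every admissible schedule, with
`C = R·M/(φ₀ (log β)^κ)`.  (For `κ = log(4/3)/log 2` this is the conclusion of XL-D.) -/
theorem cap_of_potential {a β κ R φ₀ M : ℝ} (hβ : 1 < β) (hκ : 0 ≤ κ) (hR : 0 ≤ R) (hφ₀ : 0 < φ₀)
    (y₀ : ℝ → ℝ) (hy : ∀ b : ℝ, 0 ≤ b → 0 ≤ y₀ b ∧ y₀ b ≤ R / (b + β))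
    (Φ : Sched → ℝ)
    (hbase : ∀ b : ℝ, 0 ≤ b → φ₀ * share β (base b) ≤ Φ (base b))
    (hM : ∀ s : Sched, Admissible a β s → Φ s ≤ M)
    (hpair : ∀ s t : Sched, Admissible a β (node s t) → ∀ x : ℝ, 0 ≤ x → x ≤ 1 →
      (1 - (β - 1) * share β t) * Φ s * x ^ κ + (1 - (β - 1) * share β s) * Φ t * (1 - x) ^ κ ≤
        Φ (node s t)) :
    ∀ s : Sched, Admissible a β s →
      dev β y₀ s ≤ R * M / (φ₀ * Real.log β ^ κ) * logSize β s ^ κ := by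
  intro s hs
  have hlogβ : 0 < Real.log β := Real.log_pos hβ
  have hpowβ : 0 < Real.log β ^ κ := Real.rpow_pos_of_pos hlogβ κ
  set U := R / (φ₀ * Real.log β ^ κ) with hU
  have hU0 : 0 ≤ U := div_nonneg hR (mul_nonneg hφ₀.le hpowβ.le)
  have hleaf : ∀ b : ℝ, Admissible a β (base b) →
      y₀ b ≤ U * Φ (base b) * logSize β (base b) ^ κ := by
    intro b hb
    have hb0 : 0 ≤ b := hb.1
    exact leaf_bound hβ hκ hR hφ₀ Φ y₀ hb0 (hy b hb0).2 (hbase b hb0)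
  have hcap := cap_of_pair_criterion hβ hκ hU0 Φ y₀ hleaf hpair s hs
  have hS0 : 0 ≤ logSize β s ^ κ := Real.rpow_nonneg (logSize_pos hβ s hs).le κ
  have hΦM := hM s hs
  calc dev β y₀ s ≤ U * Φ s * logSize β s ^ κ := hcap
    _ ≤ U * M * logSize β s ^ κ := by
        apply mul_le_mul_of_nonneg_right _ hS0
        exact mul_le_mul_of_nonneg_left hΦM hU0
    _ = R * M / (φ₀ * Real.log β ^ κ) * logSize β s ^ κ := by
        rw [hU]; ring

/-- **XL-D, conditional form.**  The cap conjecture XL-D of kernel XLI-A holds as soon as, for each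
admissible dial `(a, β)`, some potential with a share-proportional base value, a global bound and the
pair criterion at exponent `κ_S = log(4/3)/log 2` exists. -/
theorem capConjecture_of_potentials
    (hex : ∀ a β : ℝ, 2 ≤ a → 1 < β → β < 2 →
      ∃ (Φ : Sched → ℝ) (φ₀ M : ℝ), 0 < φ₀ ∧
        (∀ b : ℝ, 0 ≤ b → φ₀ * share β (base b) ≤ Φ (base b)) ∧
        (∀ s : Sched, Admissible a β s → Φ s ≤ M) ∧
        (∀ s t : Sched, Admissible a β (node s t) → ∀ x : ℝ, 0 ≤ x → x ≤ 1 →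
          (1 - (β - 1) * share β t) * Φ s * x ^ (Real.log (4 / 3) / Real.log 2) +
            (1 - (β - 1) * share β s) * Φ t * (1 - x) ^ (Real.log (4 / 3) / Real.log 2) ≤
            Φ (node s t))) :
    ∀ a β R : ℝ, 2 ≤ a → 1 < β → β < 2 → 0 ≤ R → ∀ y₀ : ℝ → ℝ,
      (∀ b : ℝ, 0 ≤ b → 0 ≤ y₀ b ∧ y₀ b ≤ R / (b + β)) →
      ∃ C : ℝ, ∀ s : Sched, Admissible a β s →
        dev β y₀ s ≤ C * logSize β s ^ (Real.log (4 / 3) / Real.log 2) := by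
  intro a β R ha hβ hβ2 hR y₀ hy
  obtain ⟨Φ, φ₀, M, hφ₀, hbase, hM, hpair⟩ := hex a β ha hβ hβ2
  exact ⟨R * M / (φ₀ * Real.log β ^ (Real.log (4 / 3) / Real.log 2)),
    cap_of_potential hβ kappaS_nonneg hR hφ₀ y₀ hy Φ hbase hM hpair⟩

end Summit.MatrixMultiplication.MatrixMultiplication.Theorems.FarEdgeDescentPotentialCap
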